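import Mathlib
import HarnessLib

/-!
# Translating the far channel inequality along the line

Analysis/PDE support file (everything proved, no definitions). The one-ended exterior channel
inequality of `FixedModeChannels` (far side) is invariant under translations `x = d + y`: if it
holds at the edge `ρ` for the translated potential `Ṽ(y) = V(d+y)` and the translated function
`ψ̃(t,y) = ψ(t,d+y)`, then it holds at the edge `d + ρ` for `V` and `ψ`, with the same constant
(`farChannel_translate`). The kernels (t-polynomial `C²` solutions on the far cones) correspond
under `p ↦ p(·, · − d)`, and the lower Lebesgue integrals over `(ρ,∞)` are translated without any
measurability (`lintegral_Ioi_comp_const_add'`, translation invariance of Lebesgue measure). Route PhotonSphereChannels, `FixedModeChannels`, far side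
(stmt-FinalStateConjecture-10048): reduces the far half-line estimate for every tortoise function
`r(x) = r₀(x − x_c)` to the one for the canonical `r₀`. Folklore.
-/

noncomputable section

namespace Literature.Analysis.PDE

open MeasureTheory Set Filter Topology

/-- Translating a lower Lebesgue integral over a half-line (no measurability needed). [folklore] -/
theorem lintegral_Ioi_comp_const_add' (G : ℝ → ENNReal) (d ρ : ℝ) :
    ∫⁻ y in Ioi ρ, G (d + y) = ∫⁻ x in Ioi (d + ρ), G x := by
  have hpre : (fun y : ℝ => d + y) ⁻¹' Ioi (d + ρ) = Ioi ρ := by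
    ext y
    simp only [mem_preimage, mem_Ioi]
    constructor <;> intro h <;> linarith
  have hmp : MeasurePreserving (fun y : ℝ => d + y) (volume.restrict (Ioi ρ))
      (volume.restrict (Ioi (d + ρ))) := by
    have h := (measurePreserving_add_left (volume : Measure ℝ) d).restrict_preimage
      (measurableSet_Ioi (a := d + ρ))
    rwa [hpre] at h
  rw [← hmp.map_eq, (measurableEmbedding_addLeft d).lintegral_map]

variable {V Vt : ℝ → ℝ} {ψ : ℝ → ℝ → ℝ} {d ρ c : ℝ}

/-- **Translation invariance of the far channel inequality.** See the module docstring.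
[folklore] -/
theorem farChannel_translate (hVt : ∀ y, Vt y = V (d + y))
    (h : ENNReal.ofReal c *
        (⨅ p ∈ {p : ℝ → ℝ → ℝ | ContDiffOn ℝ 2 (Function.uncurry p) {z : ℝ × ℝ | ρ + |z.1| < z.2} ∧
        (∀ z ∈ {z : ℝ × ℝ | ρ + |z.1| < z.2}, iteratedDeriv 2 (fun τ => p τ z.2) z.1
          - iteratedDeriv 2 (p z.1) z.2 + Vt z.2 * p z.1 z.2 = 0) ∧
        ∃ (N : ℕ) (a : ℕ → ℝ → ℝ), ∀ z ∈ {z : ℝ × ℝ | ρ + |z.1| < z.2},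
          p z.1 z.2 = ∑ i ∈ Finset.range N, a i z.2 * z.1 ^ i},
          ∫⁻ y in Ioi ρ, ENNReal.ofReal (deriv (fun τ => ψ τ (d + y) - p τ y) 0 ^ 2
          + deriv (fun y => ψ 0 (d + y) - p 0 y) y ^ 2 + Vt y * (ψ 0 (d + y) - p 0 y) ^ 2))
      ≤ liminf (fun t => ∫⁻ y in Ioi (ρ + |t|), ENNReal.ofReal
            (deriv (fun τ => ψ τ (d + y)) t ^ 2 + deriv (fun y => ψ t (d + y)) y ^ 2
              + Vt y * ψ t (d + y) ^ 2)) atTop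
        + liminf (fun t => ∫⁻ y in Ioi (ρ + |t|), ENNReal.ofReal
            (deriv (fun τ => ψ τ (d + y)) t ^ 2 + deriv (fun y => ψ t (d + y)) y ^ 2
              + Vt y * ψ t (d + y) ^ 2)) atBot) :
    ENNReal.ofReal c *
        (⨅ p ∈ {p : ℝ → ℝ → ℝ | ContDiffOn ℝ 2 (Function.uncurry p) {z : ℝ × ℝ | d + ρ + |z.1| < z.2} ∧
        (∀ z ∈ {z : ℝ × ℝ | d + ρ + |z.1| < z.2}, iteratedDeriv 2 (fun τ => p τ z.2) z.1
          - iteratedDeriv 2 (p z.1) z.2 + V z.2 * p z.1 z.2 = 0) ∧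
        ∃ (N : ℕ) (a : ℕ → ℝ → ℝ), ∀ z ∈ {z : ℝ × ℝ | d + ρ + |z.1| < z.2},
          p z.1 z.2 = ∑ i ∈ Finset.range N, a i z.2 * z.1 ^ i},
          ∫⁻ x in Ioi (d + ρ), ENNReal.ofReal (deriv (fun τ => ψ τ x - p τ x) 0 ^ 2
          + deriv (fun y => ψ 0 y - p 0 y) x ^ 2 + V x * (ψ 0 x - p 0 x) ^ 2))
      ≤ liminf (fun t => ∫⁻ x in Ioi (d + ρ + |t|), ENNReal.ofReal
            (deriv (fun τ => ψ τ x) t ^ 2 + deriv (ψ t) x ^ 2 + V x * ψ t x ^ 2)) atTop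
        + liminf (fun t => ∫⁻ x in Ioi (d + ρ + |t|), ENNReal.ofReal
            (deriv (fun τ => ψ τ x) t ^ 2 + deriv (ψ t) x ^ 2 + V x * ψ t x ^ 2)) atBot := by
  -- the channel energies agree
  have hE : ∀ t, (∫⁻ y in Ioi (ρ + |t|), ENNReal.ofReal
      (deriv (fun τ => ψ τ (d + y)) t ^ 2 + deriv (fun y => ψ t (d + y)) y ^ 2
        + Vt y * ψ t (d + y) ^ 2))
      = ∫⁻ x in Ioi (d + ρ + |t|), ENNReal.ofReal (deriv (fun τ => ψ τ x) t ^ 2 + deriv (ψ t) x ^ 2 + V x * ψ t x ^ 2) := by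
    intro t
    rw [show d + ρ + |t| = d + (ρ + |t|) by ring, ← lintegral_Ioi_comp_const_add' _ d (ρ + |t|)]
    refine lintegral_congr fun y => ?_
    rw [hVt y, deriv_comp_const_add (ψ t) d y]
  have hEtop : (fun t => ∫⁻ y in Ioi (ρ + |t|), ENNReal.ofReal
      (deriv (fun τ => ψ τ (d + y)) t ^ 2 + deriv (fun y => ψ t (d + y)) y ^ 2
        + Vt y * ψ t (d + y) ^ 2))
      = fun t => ∫⁻ x in Ioi (d + ρ + |t|), ENNReal.ofReal (deriv (fun τ => ψ τ x) t ^ 2 + deriv (ψ t) x ^ 2 + V x * ψ t x ^ 2) :=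
    funext hE
  rw [hEtop] at h
  refine le_trans ?_ h
  refine mul_le_mul' le_rfl (le_iInf₂ fun p hp => ?_)
  obtain ⟨hpC, hpsol, N, co, hco⟩ := hp
  -- the translated kernel element
  set q : ℝ → ℝ → ℝ := fun t x => p t (x - d) with hq
  have hqmem : q ∈ {p : ℝ → ℝ → ℝ | ContDiffOn ℝ 2 (Function.uncurry p) {z : ℝ × ℝ | d + ρ + |z.1| < z.2} ∧
        (∀ z ∈ {z : ℝ × ℝ | d + ρ + |z.1| < z.2}, iteratedDeriv 2 (fun τ => p τ z.2) z.1
          - iteratedDeriv 2 (p z.1) z.2 + V z.2 * p z.1 z.2 = 0) ∧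
        ∃ (N : ℕ) (a : ℕ → ℝ → ℝ), ∀ z ∈ {z : ℝ × ℝ | d + ρ + |z.1| < z.2},
          p z.1 z.2 = ∑ i ∈ Finset.range N, a i z.2 * z.1 ^ i} := by
    refine ⟨?_, ?_, ?_⟩
    · have hmap : ContDiff ℝ 2 (fun z : ℝ × ℝ => (z.1, z.2 - d)) :=
        contDiff_fst.prodMk (contDiff_snd.sub contDiff_const)
      have hmaps : MapsTo (fun z : ℝ × ℝ => (z.1, z.2 - d)) {z : ℝ × ℝ | d + ρ + |z.1| < z.2}
          {z : ℝ × ℝ | ρ + |z.1| < z.2} := by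
        intro z hz
        have h1 : d + ρ + |z.1| < z.2 := hz
        show ρ + |z.1| < z.2 - d
        linarith
      have hcomp : Function.uncurry q = Function.uncurry p ∘ fun z : ℝ × ℝ => (z.1, z.2 - d) := by
        funext z; rfl
      rw [hcomp]
      exact hpC.comp hmap.contDiffOn hmaps
    · intro z hz
      have h1 : d + ρ + |z.1| < z.2 := hz
      have hz' : (z.1, z.2 - d) ∈ {z : ℝ × ℝ | ρ + |z.1| < z.2} := by
        show ρ + |z.1| < z.2 - d
        linarith
      have hs := hpsol (z.1, z.2 - d) hz'
      simp only at hs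
      show iteratedDeriv 2 (fun τ => p τ (z.2 - d)) z.1 - iteratedDeriv 2 (fun x => p z.1 (x - d)) z.2
        + V z.2 * p z.1 (z.2 - d) = 0
      rw [iteratedDeriv_comp_sub_const 2 (p z.1) d]
      have hV' : V z.2 = Vt (z.2 - d) := by rw [hVt]; congr 1; ring
      rw [hV']
      exact hs
    · exact ⟨N, fun i x => co i (x - d), fun z hz => by
        have h1 : d + ρ + |z.1| < z.2 := hz
        have hz' : (z.1, z.2 - d) ∈ {z : ℝ × ℝ | ρ + |z.1| < z.2} := by
          show ρ + |z.1| < z.2 - d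
          linarith
        simpa only [hq] using hco (z.1, z.2 - d) hz'⟩
  refine (iInf₂_le q hqmem).trans (le_of_eq ?_)
  -- the two initial deviations agree
  rw [← lintegral_Ioi_comp_const_add' _ d ρ]
  refine lintegral_congr fun y => ?_
  have e2 : deriv (fun y' => ψ 0 y' - q 0 y') (d + y) = deriv (fun y => ψ 0 (d + y) - p 0 y) y := by
    rw [← deriv_comp_const_add (fun y' => ψ 0 y' - q 0 y') d y]
    simp only [hq, add_sub_cancel_left]
  rw [e2]
  simp only [hq, add_sub_cancel_left, ← hVt]

end Literature.Analysis.PDE
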